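import Literature.NumberTheory.EllipticCurves.HeegnerPointsKolyvaginPrimaryRamifiedProofs
import Literature.NumberTheory.EllipticCurves.KolyvaginPrimeTorsionFixingOfIndex

/-!
# Route `GenusKolyvaginAtTwo`, LINE 6 of crux `KolyvaginExactAtTwo`: Q2 `KolyvaginRelationAtTwo`
# — McCallum Prop. 4.4 / Gross Prop. 6.2 (2) in order form AT EVERY PRIME `p`, including `p = 2`,
# from the reduction datum at `λ` (helper, PROVED; seat `bsd-line-gk2-p2` g5, cell `bsd-f1-sign2`)

Item stmt-BirchSwinnertonDyer-24880 (`KolyvaginRelationAtTwo`, Q2 of the split of crux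
stmt-BirchSwinnertonDyer-22137) asks for the tree fact
`McCallum1991.prop44_localOrder_kolyvaginClass_mul_eq` (McCallum 1991 Prop. 4.4 «in particular»:
`ord d_M(mℓ)_λ = ord c_M(mℓ)_λ = ord c_M(m)_λ`) with `p := 2`; its docstring: *"the bet is that the
proof (local Tate duality at `λ`, `E(K_λ)/2^M ≅ H¹(K_λ,E)[2^M]`, Frobenius = `τ` on `E[2^M]`) goes
through at `2`"*. THIS FILE SETTLES THE BET ON THE ABSTRACT REDUCTION DATUM: the tree's odd-`p` theorem
`zsmul_kolyvaginClass_mem_selmerLocalKer_iff_mem_torsionLocalKer` (file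
`HeegnerPointsKolyvaginPrimaryRamifiedProofs`, §4) uses `p ≠ 2` at exactly one place — McCallum's
`ker χ_ℓ = p^M Ẽ(𝔽_λ)` (Prop. 4.4 (2)), proved there through the `±`-eigenspaces of `Frob(ℓ)`
(*"cyclic of order `ℓ + 1 ∓ a_ℓ`"*, `2 ∈ (ℤ/p^M)^×`). Here that step is replaced by an
EIGENSPACE-FREE argument valid for every `p` (indeed for every integer `n = p^M`):

* §1 `chi_eq_zero_iff_exists_zsmul_eq_of_charpoly` — let `B` be an abelian group (`Ẽ(\bar 𝔽_ℓ)`),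
  `φ : B → B` additive with the FROBENIUS EQUATION `φ² − a φ + ℓ = 0` on ALL of `B` (Silverman
  V.2.3.1; not only on `Ẽ(𝔽_λ) = {φ² = 1}`), `ℓ + 1 = n l'`, `a = n a'`, and `B` `n`-divisible
  (`\bar 𝔽_ℓ` is algebraically closed). Then for `c` with `φ²c = c`:
  **`a' c − l' φ c = 0 ⟺ c ∈ n · {φ² = 1}`**. Proof: if `n y = c` then
  `φ²y − y = a φ y − (ℓ+1) y = a' φ c − l' c = φ(a' c − l' φ c)`; conversely `φ² y = y` gives
  `(ℓ+1) y = a φ y`, hence `a y = (ℓ+1) φ y`.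
* §2 `zsmul_kolyvaginClass_mem_selmerLocalKer_iff_mem_torsionLocalKer_of_charpoly` — the tree's §4
  theorem VERBATIM (same cohomological shell: `zsmul_kolyvaginClass_mem_selmerLocalKer_iff_of_red`,
  `zsmul_kolyvaginClass_mem_torsionLocalKer_iff_of_red`, `rootIn_pow_smul_sub`) for ANY prime `p`,
  with the hypotheses `p ≠ 2`, `htors`, `hchar` (on `{φ² = 1}`), `hcyc` (cyclic eigen-parts) and `hBn`
  REPLACED by `hcharB` (Frobenius equation on `B`) and `hdivB` (`p^M`-divisibility of `B`) — both
  hold for the intended instantiation `B = Ẽ_λ(\bar 𝔽_ℓ)` (tree: Manin's relation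
  `frobenius_sq_sub_trace_smul_add_card_smul`; divisibility of points over an algebraically closed
  field). Conclusion: for every `k`, `k c(P_{mℓ})` is Selmer at `λ` iff `k c(P_m)_λ = 0`.
* §3 `zsmul_kolyvaginClass_mem_selmerLocalKer_iff_of_zhangKolyvaginPrime` — §2 at a Kolyvagin prime
  in ZHANG's numerical currency `Zhang2014.IsKolyvaginPrime N W K p ℓ ∧ M ≤ M(ℓ)` (the binders of
  Q2; at `p = 2` this is `2^M ∣ ℓ + 1`, `2^M ∣ a_ℓ`, `ℓ` inert, with NO Frobenius-class condition),
  for `E = W/ℚ` over an imaginary quadratic `K`: the place `λ`, the prime `𝔓 ∣ λ`, an arithmetic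
  Frobenius `F` at `𝔓` FIXING `E[p^M]` (tree theorem
  `exists_isArithFrobAt_mem_torsionFixing_of_le_kolyvaginIndex` — Manin's relation + the congruences,
  any `p`) and `E(K̄)[p^M] ≃ E(K̄_λ)[p^M]` are supplied by the tree; the reduction datum modulo `𝔓`
  (reduction map on `E(K̄)`, inertia action on `E(K_{mℓ})` through `⟨σ_ℓ⟩`, the Euler-system root
  `R₀ = (σ_ℓ − 1)P_{mℓ}/p^M` with Gross's congruence `red R₀ = l' φ(red P_m) − a' red P_m`
  (Prop. 3.7 (2), Eichler–Shimura), `F P_m = P_m`) stays a displayed hypothesis, exactly as in the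
  tree's odd-`p` `zsmul_kolyvaginClass_mem_selmerLocalKer_iff_of_isKolyvaginPrime`.
* §4 `kolyvaginRelationAtTwo_local_of_charpoly` — the `p = 2` specialisation in the currency of Q2.

WHAT THIS SAYS ABOUT Q2. The `p = 2` obstruction named in the item («at `p = 2` … the `±`-splitting
degenerates») is NOT an obstruction for Prop. 4.4 in order form: both conjuncts of
`KolyvaginRelationAtTwo` follow at `2` from the same reduction datum as at odd `p`, with no parity /
Frobenius-class / sign-of-`Δ` condition. What is NOT done here (and is not in the tree at any `p`;
it is why the odd-`p` statement is the unproved named fact `McCallum1991.prop44_…`): the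
instantiation of the datum for `KolyvaginHeegnerData` (reduction of `E(K̄)` modulo `𝔓 ∣ λ` beyond
torsion, Gross Prop. 3.7 (2) `y_n ≡ Frob · y_m (mod λ_n)`, total ramification of `λ_m` in `K_n`).
BSD is not proved by any of this; Q2 is not closed by this file.

References: [McCallumLMS1991] §4 Lemma 4.3, Prop. 4.4 (pp. 301–302); [GrossLMS1991] §3 (3.3),
Prop. 3.7, §6 Prop. 6.2 (2), §7 (7.1), Prop. 9.6; [SilvermanAEC2009] V.2.3.1, VII.3.1(b), VII.4.1;
[WZhang2014] Notations (xii); [Jetchev2008] §3.2.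
-/

set_option autoImplicit false
set_option linter.dupNamespace false

noncomputable section

open scoped Classical

namespace Summit.BirchSwinnertonDyer.BirchSwinnertonDyer.Theorems.GenusExact

open WeierstrassCurve NumberField IsDedekindDomain Field Finset
open Literature.NumberTheory.GaloisRepresentations Literature.NumberTheory.EllipticCurves
open Literature.NumberTheory.EllipticCurves.KolyvaginCocycle

universe u

/-! ### §1 The finite-group core at every `p`: `ker χ_ℓ = n · Ẽ(𝔽_λ)` from the Frobenius equation -/

/-- **McCallum 1991 Prop. 4.4 (2), `ker χ_ℓ = p^M Ẽ(𝔽_λ)`, eigenspace-free (valid at `p = 2`).**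
Let `B` be an abelian group with an additive `φ` satisfying the Frobenius equation
`φ(φ b) + ℓ b = a φ(b)` on all of `B`, let `ℓ + 1 = n l'`, `a = n a'`, and let `B` be `n`-divisible.
For `c ∈ B` with `φ(φ c) = c`: `a' c − l' φ(c) = 0` iff `c = n y` for some `y` with `φ(φ y) = y`.
[cite: McCallumLMS1991, Prop. 4.4 (2)] [cite: SilvermanAEC2009, V.2.3.1] -/
theorem chi_eq_zero_iff_exists_zsmul_eq_of_charpoly {B : Type*} [AddCommGroup B] (φ : B →+ B)
    {ℓ : ℕ} {n a l' a' : ℤ}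
    (hcharB : ∀ b : B, φ (φ b) + (ℓ : ℤ) • b = a • φ b)
    (hl' : ((ℓ + 1 : ℕ) : ℤ) = n * l') (ha' : a = n * a')
    (hdivB : ∀ b : B, ∃ y : B, n • y = b)
    {c : B} (hc : φ (φ c) = c) :
    a' • c - l' • φ c = 0 ↔ ∃ y : B, φ (φ y) = y ∧ n • y = c := by
  have hl1 : ((ℓ : ℤ) + 1) = n * l' := by exact_mod_cast hl'
  -- the Frobenius equation in the form `φ² y - y = a φ y - (ℓ + 1) y`
  have hkey : ∀ y : B, φ (φ y) - y = a' • φ (n • y) - l' • (n • y) := fun y ↦ by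
    have h := hcharB y
    rw [map_zsmul, smul_smul, smul_smul, mul_comm a' n, mul_comm l' n, ← ha', ← hl1, add_smul,
      one_smul]
    rw [← h]
    abel
  constructor
  · intro hχ
    obtain ⟨y, hy⟩ := hdivB c
    refine ⟨y, ?_, hy⟩
    -- `φ² y - y = a' φ c - l' c = φ (a' c - l' φ c) = 0`
    have h1 : a' • φ c - l' • c = 0 := by
      have h2 : φ (a' • c - l' • φ c) = 0 := by rw [hχ, map_zero]
      rwa [map_sub, map_zsmul, map_zsmul, hc] at h2
    rw [← sub_eq_zero, hkey y, hy, h1]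
  · rintro ⟨y, hyy, rfl⟩
    -- `(ℓ + 1) y = a φ y`, hence `a y = (ℓ + 1) φ y`
    have h1 : ((ℓ : ℤ) + 1) • y = a • φ y := by
      have h := hcharB y
      rw [hyy] at h
      rw [add_smul, one_smul, add_comm]
      exact h
    have h2 : a • y = ((ℓ : ℤ) + 1) • φ y := by
      have h3 := congrArg φ h1
      rw [map_zsmul, map_zsmul, hyy] at h3
      exact h3.symm
    rw [map_zsmul, smul_smul, smul_smul, mul_comm a' n, mul_comm l' n, ← ha', ← hl1, h2, sub_self]

/-! ### §2 Prop. 4.4 in order form at every prime `p`, from the reduction datum at `λ` -/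

section Ramified

variable {K : Type u} [Field K] [NumberField K] (W : WeierstrassCurve K) [W.IsElliptic]

set_option maxHeartbeats 800000 in
/-- **McCallum 1991 Prop. 4.4 / Gross 1991 Prop. 6.2 (2) in order form, at EVERY prime `p`
(including `p = 2`), from an abstract reduction datum at `λ`.** Same setting, binders and
cohomological shell as the tree's odd-`p`
`zsmul_kolyvaginClass_mem_selmerLocalKer_iff_mem_torsionLocalKer` (`n = p^M`; `P₁ = P_{mℓ} ∈ A₁`,
`P₂ = P_m ∈ A₂` admissible; `v = λ` good with `λ ∤ p`; `F` an arithmetic Frobenius at the prime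
`𝔓 ∣ λ` cut out by the completion, fixing `E[p^M]`; `red : E(K̄) → B` the reduction mod `𝔓`,
`I_𝔓`-invariant, injective on `E[p^M]`, `red ∘ F = φ² ∘ red`; the inertia action on `A₁` through
`⟨τ₀⟩`; the Euler-system root `R₀` with `red R₀ = l' φ(red P₂) − a' red P₂`; `F P₂ = P₂`; `c(P₂)`
Selmer at `λ`), EXCEPT that the hypotheses `p ≠ 2`, finiteness of orders on `{φ² = 1}`, the
characteristic relation on `{φ² = 1}`, the cyclic `±`-eigen-parts and `φ² = 1` on `B[p^M]` are
replaced by the FROBENIUS EQUATION `φ² − a φ + ℓ = 0` on all of `B` (`hcharB`) and the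
`p^M`-DIVISIBILITY of `B` (`hdivB`). Conclusion: for every `k`, `k c(P₁)` satisfies the Selmer
condition at `λ` iff `k c(P₂)_λ = 0` in `H¹(K_λ, E[p^M])`. [cite: McCallumLMS1991, Prop. 4.4]
[cite: GrossLMS1991, Prop. 6.2 (2)] -/
theorem zsmul_kolyvaginClass_mem_selmerLocalKer_iff_mem_torsionLocalKer_of_charpoly
    {p : ℕ} (hp : p.Prime) {M : ℕ}
    {hdiv : ∀ P : geomPoints W, ∃ Q : geomPoints W, ((p ^ M : ℕ) : ℤ) • Q = P}
    {A₁ A₂ : AddSubgroup (geomPoints W)}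
    (hA₁ : IsAdmissible (absoluteGaloisGroup K) A₁ ((p ^ M : ℕ) : ℤ))
    (hA₂ : IsAdmissible (absoluteGaloisGroup K) A₂ ((p ^ M : ℕ) : ℤ))
    {P₁ P₂ : geomPoints W}
    (hP₁ : P₁ ∈ invPoints (absoluteGaloisGroup K) A₁ ((p ^ M : ℕ) : ℤ))
    (hP₂ : P₂ ∈ invPoints (absoluteGaloisGroup K) A₂ ((p ^ M : ℕ) : ℤ))
    -- the place `λ`
    {v : HeightOneSpectrum (𝓞 K)} (hgood : W.HasGoodReductionAt v) (hpv : (p : 𝓞 K) ∉ v.asIdeal)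
    {𝔐 : Ideal (HeightOneSpectrum.localAbsIntegers v)} (h𝔐 : 𝔐 ∈ v.localPrimesAbove)
    {F : absoluteGaloisGroup K}
    (hF : IsArithFrobAt (𝓞 K) F (v.primeBelow (closureEmb (K := K) (v.adicCompletion K)) 𝔐))
    (hFfix : F ∈ torsionFixing W ((p ^ M : ℕ) : ℤ))
    (hsurj : Function.Surjective (torsionPointsMap W (v.adicCompletion K) ((p ^ M : ℕ) : ℤ)))
    -- the reduction datum at `𝔓`
    {B : Type*} [AddCommGroup B] (red : geomPoints W →+ B) (φ : B →+ B)
    (hredI : ∀ τ ∈ (v.primeBelow (closureEmb (K := K) (v.adicCompletion K)) 𝔐).inertia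
      (absoluteGaloisGroup K), ∀ x : geomPoints W, red (τ • x) = red x)
    (hredF : ∀ x : geomPoints W, red (F • x) = φ (φ (red x)))
    (hred : ∀ x : geomPoints W, ((p ^ M : ℕ) : ℤ) • x = 0 → red x = 0 → x = 0)
    -- the arithmetic of `B = Ẽ(\bar F_ℓ)`: Frobenius equation and divisibility
    {ℓ : ℕ} {a l' a' : ℤ} (hl' : ((ℓ + 1 : ℕ) : ℤ) = (p : ℤ) ^ M * l')
    (ha' : a = (p : ℤ) ^ M * a')
    (hcharB : ∀ b : B, φ (φ b) + (ℓ : ℤ) • b = a • φ b)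
    (hdivB : ∀ b : B, ∃ y : B, ((p ^ M : ℕ) : ℤ) • y = b)
    -- the Euler-system data at `λ`
    {τ₀ : absoluteGaloisGroup K}
    (hτ₀ : τ₀ ∈ (v.primeBelow (closureEmb (K := K) (v.adicCompletion K)) 𝔐).inertia
      (absoluteGaloisGroup K))
    (hIτ₀ : ∀ τ ∈ (v.primeBelow (closureEmb (K := K) (v.adicCompletion K)) 𝔐).inertia
      (absoluteGaloisGroup K), ∃ i : ℕ, ∀ x ∈ A₁, τ • x = (τ₀ ^ i) • x)
    {R₀ : geomPoints W} (hR₀A : R₀ ∈ A₁) (hR₀ : ((p ^ M : ℕ) : ℤ) • R₀ = τ₀ • P₁ - P₁)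
    (hR₀red : red R₀ = l' • φ (red P₂) - a' • red P₂)
    (hFP₂ : F • P₂ = P₂)
    (hsel₂ : kolyvaginClass W _ hdiv hA₂ P₂ hP₂ ∈
      selmerLocalKer W (v.adicCompletion K) ((p ^ M : ℕ) : ℤ))
    (k : ℤ) :
    k • kolyvaginClass W _ hdiv hA₁ P₁ hP₁ ∈ selmerLocalKer W (v.adicCompletion K) ((p ^ M : ℕ) : ℤ) ↔
      k • kolyvaginClass W _ hdiv hA₂ P₂ hP₂ ∈
        W.torsionLocalKer (v.adicCompletion K) ((p ^ M : ℕ) : ℤ) := by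
  set 𝔓 := v.primeBelow (closureEmb (K := K) (v.adicCompletion K)) 𝔐 with h𝔓def
  have h𝔓 : 𝔓 ∈ v.primesAbove := HeightOneSpectrum.primeBelow_mem_primesAbove h𝔐
  have hnZ : ((p ^ M : ℕ) : ℤ) = (p : ℤ) ^ M := by push_cast; rfl
  have hn0 : ((p ^ M : ℕ) : ℤ) ≠ 0 := by exact_mod_cast pow_ne_zero M hp.ne_zero
  have hnv : ((((p ^ M : ℕ) : ℤ)) : 𝓞 K) ∉ v.asIdeal := by
    rw [Int.cast_natCast, Nat.cast_pow]
    exact fun h ↦ hpv (v.isPrime.mem_of_pow_mem M h)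
  have hl1 : ((ℓ : ℤ) + 1) = (p : ℤ) ^ M * l' := by exact_mod_cast hl'
  -- `φ² = 1` on `B[p^M]` (from the Frobenius equation and the congruences)
  have hBn : ∀ b : B, ((p ^ M : ℕ) : ℤ) • b = 0 → φ (φ b) = b := fun b hb ↦ by
    rw [hnZ] at hb
    have h := hcharB b
    have h1 : a • φ b = 0 := by rw [ha', mul_comm, mul_smul, ← map_zsmul, hb, map_zero, smul_zero]
    have h2 : (ℓ : ℤ) • b = -b := by
      rw [show (ℓ : ℤ) = (p : ℤ) ^ M * l' - 1 by rw [← hl1]; ring, sub_smul, one_smul, mul_comm,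
        mul_smul, hb, smul_zero, zero_sub]
    rw [h1, h2, ← sub_eq_add_neg, sub_eq_zero] at h
    exact h
  -- ### left side: `k · red R₀ = 0`
  have hL : k • kolyvaginClass W _ hdiv hA₁ P₁ hP₁ ∈
      selmerLocalKer W (v.adicCompletion K) ((p ^ M : ℕ) : ℤ) ↔ k • red R₀ = 0 := by
    rw [zsmul_kolyvaginClass_mem_selmerLocalKer_iff_of_red W hA₁ hP₁ hgood hnv h𝔓 red hredI
      hred k]
    have hroot : rootIn A₁ ((p ^ M : ℕ) : ℤ) (τ₀ • P₁ - P₁) = R₀ :=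
      rootIn_eq hA₁.eq_zero_of_zsmul hR₀A hR₀
    constructor
    · intro h
      have h0 := h τ₀ hτ₀
      rwa [hroot] at h0
    · intro h τ hτ
      obtain ⟨i, hi⟩ := hIτ₀ τ hτ
      rw [hi P₁ hP₁.1, rootIn_pow_smul_sub hA₁ hP₁ τ₀ i, hroot, map_sum,
        sum_congr rfl fun j _ ↦ hredI _ (pow_mem hτ₀ j) R₀, sum_const, card_range,
        ← natCast_zsmul, zsmul_comm, h, zsmul_zero]
  -- ### right side: `k P̃₂ = p^M b` with `φ² b = b`
  have hP₂C : φ (φ (k • red P₂)) = k • red P₂ := by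
    rw [← map_zsmul, ← hredF, smul_comm, hFP₂]
  have hR : k • kolyvaginClass W _ hdiv hA₂ P₂ hP₂ ∈
      W.torsionLocalKer (v.adicCompletion K) ((p ^ M : ℕ) : ℤ) ↔
      ∃ y : B, φ (φ y) = y ∧ ((p ^ M : ℕ) : ℤ) • y = k • red P₂ := by
    rw [zsmul_kolyvaginClass_mem_torsionLocalKer_iff_of_red W hA₂ hP₂ hgood hnv hn0 h𝔐 hF hFfix
      hsurj hsel₂ hFP₂ red (φ.comp φ) (fun x ↦ hredF x) hred (fun b hb ↦ hBn b hb) k]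
    constructor
    · rintro ⟨b, hb, hkb⟩
      exact ⟨b, hb, hkb.symm⟩
    · rintro ⟨y, hy, hky⟩
      exact ⟨y, hy, hky.symm⟩
  rw [hL, hR]
  -- ### `k · red R₀ = 0 ⟺ χ(k P̃₂) = 0 ⟺ k P̃₂ ∈ p^M {φ² = 1}` (§1)
  have hmid : k • red R₀ = 0 ↔ a' • (k • red P₂) - l' • φ (k • red P₂) = 0 := by
    rw [hR₀red, zsmul_sub, smul_comm k l', smul_comm k a', ← map_zsmul,
      ← neg_sub (a' • (k • red P₂)), neg_eq_zero]
  rw [hmid, hnZ]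
  exact chi_eq_zero_iff_exists_zsmul_eq_of_charpoly φ hcharB (n := (p : ℤ) ^ M) hl' ha'
    (fun b ↦ by obtain ⟨y, hy⟩ := hdivB b; exact ⟨y, by rw [← hnZ]; exact hy⟩) hP₂C

end Ramified

/-! ### §3 At a Kolyvagin prime in Zhang's numerical currency (`E/ℚ`, `K` imaginary quadratic), any `p` -/

section ZhangPrime

variable {K : Type u} [Field K] [NumberField K] (W : WeierstrassCurve ℚ)

/-- **Prop. 4.4 in order form at a Kolyvagin prime `ℓ` with `M ≤ M(ℓ)` in ZHANG's currency, any
prime `p` (including `2`), granted the reduction datum modulo the primes `𝔓 ∣ λ`.** For `W/ℚ`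
elliptic in global minimal form, `K` imaginary quadratic, `ℓ` a Kolyvagin prime
(`Zhang2014.IsKolyvaginPrime N W K p ℓ`: `ℓ ∤ N d_K p`, `(ℓ)` prime in `𝓞 K`) with
`M ≤ M(ℓ) = v_p(gcd(ℓ + 1, a_ℓ))`, `v ∋ ℓ` the place of `ℚ` (good reduction) and `λ ∋ ℓ` the place of
`K` (good reduction for `E/K`): the tree supplies `λ ∤ p`, the local prime `𝔓 ∣ λ`, an arithmetic
Frobenius `F` at `𝔓` FIXING `E(K̄)[p^M]` (`exists_isArithFrobAt_mem_torsionFixing_of_le_kolyvaginIndex`: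
Manin's relation and the congruences `p^M ∣ ℓ + 1, a_ℓ` — no Frobenius-class condition (3.2)) and
`E(K̄)[p^M] ≃ E(K̄_λ)[p^M]`; the datum `hdata` (for every `𝔓 ∣ λ` and every such `F`: `F P_m = P_m`,
the reduction `red` modulo `𝔓` with its `ℓ`-power Frobenius `φ` satisfying the Frobenius equation on
`Ẽ(\bar 𝔽_ℓ)` and `p^M`-divisibility, the inertia action on `E(K_{mℓ})` through `⟨σ_ℓ⟩`, and the
Euler-system root `R₀` with Gross's congruence) stays displayed, as in the tree's odd-`p`
`zsmul_kolyvaginClass_mem_selmerLocalKer_iff_of_isKolyvaginPrime`. Conclusion: for every `k`,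
`k c(P_{mℓ})` is Selmer at `λ` iff `k c(P_m)_λ = 0`. [cite: McCallumLMS1991, Prop. 4.4]
[cite: GrossLMS1991, Prop. 6.2 (2)] [cite: WZhang2014, Notations (xii)] -/
theorem zsmul_kolyvaginClass_mem_selmerLocalKer_iff_of_zhangKolyvaginPrime [W.IsElliptic]
    [W.IsGloballyMinimal] (hK : IsImaginaryQuadratic K) {N p : ℕ} [Fact p.Prime] {M ℓ : ℕ}
    (hℓ : Zhang2014.IsKolyvaginPrime N W K p ℓ) (hM : M ≤ Zhang2014.kolyvaginIndex W p ℓ)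
    {v₀ : HeightOneSpectrum (𝓞 ℚ)} (hℓv₀ : (ℓ : 𝓞 ℚ) ∈ v₀.asIdeal) (hgood₀ : W.HasGoodReductionAt v₀)
    {v : HeightOneSpectrum (𝓞 K)} (hv : (ℓ : 𝓞 K) ∈ v.asIdeal)
    (hgood : (W.baseChange K).HasGoodReductionAt v)
    {hdiv : ∀ P : geomPoints (W.baseChange K), ∃ Q : geomPoints (W.baseChange K),
      ((p ^ M : ℕ) : ℤ) • Q = P}
    {A₁ A₂ : AddSubgroup (geomPoints (W.baseChange K))}
    (hA₁ : IsAdmissible (absoluteGaloisGroup K) A₁ ((p ^ M : ℕ) : ℤ))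
    (hA₂ : IsAdmissible (absoluteGaloisGroup K) A₂ ((p ^ M : ℕ) : ℤ))
    {P₁ P₂ : geomPoints (W.baseChange K)}
    (hP₁ : P₁ ∈ invPoints (absoluteGaloisGroup K) A₁ ((p ^ M : ℕ) : ℤ))
    (hP₂ : P₂ ∈ invPoints (absoluteGaloisGroup K) A₂ ((p ^ M : ℕ) : ℤ))
    (hsel₂ : kolyvaginClass (W.baseChange K) _ hdiv hA₂ P₂ hP₂ ∈
      selmerLocalKer (W.baseChange K) (v.adicCompletion K) ((p ^ M : ℕ) : ℤ))
    {a l' a' : ℤ} (hl' : ((ℓ + 1 : ℕ) : ℤ) = (p : ℤ) ^ M * l') (ha' : a = (p : ℤ) ^ M * a')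
    (hdata : ∀ 𝔓 ∈ v.primesAbove, ∀ F : absoluteGaloisGroup K, IsArithFrobAt (𝓞 K) F 𝔓 →
      F ∈ torsionFixing (W.baseChange K) ((p ^ M : ℕ) : ℤ) →
      F • P₂ = P₂ ∧
      ∃ (B : Type u) (_ : AddCommGroup B) (red : geomPoints (W.baseChange K) →+ B) (φ : B →+ B)
        (τ₀ : absoluteGaloisGroup K) (R₀ : geomPoints (W.baseChange K)),
        (∀ τ ∈ 𝔓.inertia (absoluteGaloisGroup K), ∀ x : geomPoints (W.baseChange K),
          red (τ • x) = red x) ∧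
        (∀ x : geomPoints (W.baseChange K), red (F • x) = φ (φ (red x))) ∧
        (∀ x : geomPoints (W.baseChange K), ((p ^ M : ℕ) : ℤ) • x = 0 → red x = 0 → x = 0) ∧
        (∀ b : B, φ (φ b) + (ℓ : ℤ) • b = a • φ b) ∧
        (∀ b : B, ∃ y : B, ((p ^ M : ℕ) : ℤ) • y = b) ∧
        τ₀ ∈ 𝔓.inertia (absoluteGaloisGroup K) ∧
        (∀ τ ∈ 𝔓.inertia (absoluteGaloisGroup K), ∃ i : ℕ, ∀ x ∈ A₁, τ • x = (τ₀ ^ i) • x) ∧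
        R₀ ∈ A₁ ∧ ((p ^ M : ℕ) : ℤ) • R₀ = τ₀ • P₁ - P₁ ∧
        red R₀ = l' • φ (red P₂) - a' • red P₂)
    (k : ℤ) :
    k • kolyvaginClass (W.baseChange K) _ hdiv hA₁ P₁ hP₁ ∈
        selmerLocalKer (W.baseChange K) (v.adicCompletion K) ((p ^ M : ℕ) : ℤ) ↔
      k • kolyvaginClass (W.baseChange K) _ hdiv hA₂ P₂ hP₂ ∈
        (W.baseChange K).torsionLocalKer (v.adicCompletion K) ((p ^ M : ℕ) : ℤ) := by
  have hp : p.Prime := Fact.out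
  haveI : CharZero (v.adicCompletion K) :=
    charZero_of_injective_algebraMap (algebraMap K (v.adicCompletion K)).injective
  have hq0 : p ^ M ≠ 0 := pow_ne_zero M hp.ne_zero
  have hpv : (p : 𝓞 K) ∉ v.asIdeal := not_natCast_mem_of_prime_ne hℓ.1 hp hℓ.2.2.2.1 _ hv
  obtain ⟨𝔐, h𝔐⟩ := v.localPrimesAbove_nonempty
  have h𝔓 : v.primeBelow (closureEmb (K := K) (v.adicCompletion K)) 𝔐 ∈ v.primesAbove :=
    HeightOneSpectrum.primeBelow_mem_primesAbove h𝔐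
  obtain ⟨F, hF, hFfix⟩ :=
    exists_isArithFrobAt_mem_torsionFixing_of_le_kolyvaginIndex W hK hℓ hM hℓv₀ hgood₀ hv h𝔓
  obtain ⟨hFP₂, B, _, red, φ, τ₀, R₀, hredI, hredF, hred, hcharB, hdivB, hτ₀, hIτ₀, hR₀A, hR₀,
    hR₀red⟩ := hdata _ h𝔓 F hF hFfix
  exact zsmul_kolyvaginClass_mem_selmerLocalKer_iff_mem_torsionLocalKer_of_charpoly
    (W.baseChange K) hp hA₁ hA₂ hP₁ hP₂ hgood hpv h𝔐 hF hFfix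
    (torsionPointsMap_bijective (W.baseChange K) (v.adicCompletion K) hq0).2 red φ hredI hredF
    hred hl' ha' hcharB hdivB hτ₀ hIτ₀ hR₀A hR₀ hR₀red hFP₂ hsel₂ k

end ZhangPrime

/-! ### §4 `p = 2`: the composite order relation of Q2 for `KolyvaginHeegnerData`, from the datum -/

section AtTwo

variable {K : Type} [Field K] [NumberField K] (W : WeierstrassCurve ℚ)

/-- **Q2 `KolyvaginRelationAtTwo` (stmt-BirchSwinnertonDyer-24880), COMPOSITE ORDER RELATION
`ord d_M(mℓ)_λ = ord c_M(m)_λ` at `p = 2`, for the tree's classes `c_M(n) = d.kolyvaginClass` of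
`KolyvaginHeegnerData`, from the reduction datum at `λ`.** In the currency of Q2: `W/ℚ` globally
minimal, `K` imaginary quadratic, `ℓ` a Kolyvagin prime at `2` in Zhang's form with
`M ≤ M(ℓ)` (`2^M ∣ ℓ + 1`, `2^M ∣ a_ℓ`), data `d` (conductor `m`) and `d'` (conductor `mℓ`) whose
point groups `E(K[m]), E(K[mℓ]) ⊆ E(K̄)` are admissible for `2^M` with `[P(m)]`, `[P(mℓ)]` invariant
mod `2^M` (Gross Lemma 4.3 / Prop. 3.6 — then `c_M(·)` IS McCallum's class,
`kolyvaginClass_of_admissible`), `c_M(m)` Selmer at `λ ∋ ℓ` (Prop. 6.2 (1)), and the reduction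
datum `hdata` modulo the primes `𝔓 ∣ λ` as in §3. Then for every `j`:
`2^j c_M(mℓ)` satisfies the Selmer condition at `λ` iff `2^j c_M(m)_λ = 0` — NO parity, sign-of-`Δ`
or Frobenius-class condition at `2`. (The two conjuncts of Q2 as typed are `ord d_M(mℓ)_λ =
ord c_M(mℓ)_λ` and `ord c_M(mℓ)_λ = ord c_M(m)_λ`; this is their composite.)
[cite: McCallumLMS1991, Prop. 4.4] [cite: GrossLMS1991, Prop. 6.2 (2)] -/
theorem kolyvaginRelationAtTwo_composite_of_datum [W.IsElliptic] [W.IsGloballyMinimal]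
    (hK : IsImaginaryQuadratic K) {N : ℕ} [NeZero N] {N' : ℕ}
    {Dt : Literature.NumberTheory.EllipticCurves.ModularForms.ModularParametrizationData W N}
    {β : ℤ} {ι : K →+* ℂ} {M m l : ℕ}
    (hℓ : Zhang2014.IsKolyvaginPrime N' W K 2 l) (hM : M ≤ Zhang2014.kolyvaginIndex W 2 l)
    (d : KolyvaginHeegnerData Dt β ι m) (d' : KolyvaginHeegnerData Dt β ι (m * l))
    (hA : IsAdmissible (absoluteGaloisGroup K) d.pointsSubgroup ((2 ^ M : ℕ) : ℤ))
    (hP : d.toGeomPoints d.derivedPoint ∈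
      invPoints (absoluteGaloisGroup K) d.pointsSubgroup ((2 ^ M : ℕ) : ℤ))
    (hA' : IsAdmissible (absoluteGaloisGroup K) d'.pointsSubgroup ((2 ^ M : ℕ) : ℤ))
    (hP' : d'.toGeomPoints d'.derivedPoint ∈
      invPoints (absoluteGaloisGroup K) d'.pointsSubgroup ((2 ^ M : ℕ) : ℤ))
    {v₀ : HeightOneSpectrum (𝓞 ℚ)} (hℓv₀ : (l : 𝓞 ℚ) ∈ v₀.asIdeal) (hgood₀ : W.HasGoodReductionAt v₀)
    {v : HeightOneSpectrum (𝓞 K)} (hv : (l : 𝓞 K) ∈ v.asIdeal)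
    (hgood : (W.baseChange K).HasGoodReductionAt v)
    (hsel : d.kolyvaginClass Nat.prime_two M ∈
      selmerLocalKer (W.baseChange K) (v.adicCompletion K) ((2 ^ M : ℕ) : ℤ))
    {a l' a' : ℤ} (hl' : ((l + 1 : ℕ) : ℤ) = (2 : ℤ) ^ M * l') (ha' : a = (2 : ℤ) ^ M * a')
    (hdata : ∀ 𝔓 ∈ v.primesAbove, ∀ F : absoluteGaloisGroup K, IsArithFrobAt (𝓞 K) F 𝔓 →
      F ∈ torsionFixing (W.baseChange K) ((2 ^ M : ℕ) : ℤ) →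
      F • d.toGeomPoints d.derivedPoint = d.toGeomPoints d.derivedPoint ∧
      ∃ (B : Type) (_ : AddCommGroup B) (red : geomPoints (W.baseChange K) →+ B) (φ : B →+ B)
        (τ₀ : absoluteGaloisGroup K) (R₀ : geomPoints (W.baseChange K)),
        (∀ τ ∈ 𝔓.inertia (absoluteGaloisGroup K), ∀ x : geomPoints (W.baseChange K),
          red (τ • x) = red x) ∧
        (∀ x : geomPoints (W.baseChange K), red (F • x) = φ (φ (red x))) ∧
        (∀ x : geomPoints (W.baseChange K), ((2 ^ M : ℕ) : ℤ) • x = 0 → red x = 0 → x = 0) ∧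
        (∀ b : B, φ (φ b) + (l : ℤ) • b = a • φ b) ∧
        (∀ b : B, ∃ y : B, ((2 ^ M : ℕ) : ℤ) • y = b) ∧
        τ₀ ∈ 𝔓.inertia (absoluteGaloisGroup K) ∧
        (∀ τ ∈ 𝔓.inertia (absoluteGaloisGroup K), ∃ i : ℕ, ∀ x ∈ d'.pointsSubgroup,
          τ • x = (τ₀ ^ i) • x) ∧
        R₀ ∈ d'.pointsSubgroup ∧
        ((2 ^ M : ℕ) : ℤ) • R₀ = τ₀ • d'.toGeomPoints d'.derivedPoint - d'.toGeomPoints d'.derivedPoint ∧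
        red R₀ = l' • φ (red (d.toGeomPoints d.derivedPoint)) - a' • red (d.toGeomPoints d.derivedPoint))
    (j : ℕ) :
    ((2 ^ j : ℕ) : ℤ) • d'.kolyvaginClass Nat.prime_two M ∈
        selmerLocalKer (W.baseChange K) (v.adicCompletion K) ((2 ^ M : ℕ) : ℤ) ↔
      ((2 ^ j : ℕ) : ℤ) • d.kolyvaginClass Nat.prime_two M ∈
        (W.baseChange K).torsionLocalKer (v.adicCompletion K) ((2 ^ M : ℕ) : ℤ) := by
  haveI : Fact (Nat.Prime 2) := ⟨Nat.prime_two⟩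
  rw [d'.kolyvaginClass_of_admissible Nat.prime_two M hA' hP', d.kolyvaginClass_of_admissible
    Nat.prime_two M hA hP]
  rw [d.kolyvaginClass_of_admissible Nat.prime_two M hA hP] at hsel
  exact zsmul_kolyvaginClass_mem_selmerLocalKer_iff_of_zhangKolyvaginPrime W hK hℓ hM hℓv₀ hgood₀ hv
    hgood hA' hA hP' hP hsel hl' ha' hdata _

end AtTwo

end Summit.BirchSwinnertonDyer.BirchSwinnertonDyer.Theorems.GenusExact

end
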